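import Literature.Analysis.FluidPDE.NormalisedPressureDischarge
import Literature.Analysis.FluidPDE.ForcePotentialRepresentation
import Literature.Analysis.FluidPDE.ForcePotentialProbeBounds
import HarnessLib

/-!
# Tao's pressure normalisation WITH a force (Lemma 4.1 (i), a.e. form) — discharged

Analysis/FluidPDE file (cell `pub/ns-blowup`, seat `ns-blowup-lit` g8; PATH B of the `E–C`
endpoint, LIT-DOSSIER §41/§43–§45). WHAT THIS IS NOT: not a regularity or blow-up statement —
the DISCHARGE `tao2011_forced_pressure_normalisation_ae_holds` of the tree's corrected fact
`tao2011_forced_pressure_normalisation_ae` (`TaoForcedNormalisedPressure`; Tao 2011, Lemma 4.1 (i)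
= arXiv:1108.1165 Lemma 25 (i), pp. 14–15, with the printed "bounded" weakened to "measurable" —
the verbatim form is refuted in `TaoForcedPressureNormalisationCounterexample`), i.e. the forced
twin of `NormalisedPressureDischarge.tao_pressure_normalisation_holds`.

For a classical solution `(u, p)` of `∂ₜu + (u·∇)u = νΔu - ∇p + f`, `div u = 0` on `[0,T] × ℝ³`
with smooth force, `sup_t ∫|u(t)|² < ∞` and `∫₀ᵀ ‖f(t)‖_{L²} dt < ∞`:

1. (`harmonicOnNhd_forcedHarmonicPart`) at every interior GOOD time (`‖f(t)‖_{L²} < ∞`; a.e. by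
   the finite energy of the data) the **forced harmonic part** `h_f(t) := p(t) - Q[u(t)] - Φ[f(t)]`
   (`Q = pressurePotential = -Δ⁻¹∂ᵢ∂ⱼ(uᵢuⱼ)` of `PressureRepresentation`,
   `Φ = forcePotential = Δ⁻¹∇·` of `TaoForcedNormalisedPressure`) is harmonic on `ℝ³`: pressure
   Poisson `Δp = -∂ᵢ∂ⱼ(uᵢuⱼ) + ∇·f` (`PressurePoisson`, with force), `ΔQ = -∂ᵢ∂ⱼ(uᵢuⱼ)`, and
   `ΔΦ[f] = ∇·f` WITHOUT compact support of `f(t)` (`ForcePotentialRepresentation`).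
2. (`fderiv_forcedHarmonicPart_eq`, Tao's computation of `∫∫ ∇h χ_R`, slice-wise) the **forced
   probe identity**: for `R > 0`, centre `x₀`, direction `a`, `φ = χ_R(· - x₀)` (`probeBump`),
   `∂ₐh_f(t, x₀) = ν∫⟪u, Δφ a⟫ + ∫⟪u, (u·∇φ) a⟫ - ∫⟪∂ₜu, φ a⟫ + ∫⟪f, φ a⟫`
   `  - ∫ ∂ₐχ_R(z) Q[u(t)](x₀ - z) dz - ∫ ∂ₐχ_R(z) Φ[f(t)](x₀ - z) dz`.
3. (`fderiv_forcedHarmonicPart_ae_eq_zero`) **`∂ₐh_f(t, x₀) = 0` for a.e. `t`**: the unforced terms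
   are `O((1 + E₀)/R)` (`NormalisedPressureDischarge.exists_bound_probe_*`), the force terms
   `O(‖f(t)‖_{L²}/R)` (`ForcePotentialProbeBounds`), the boundary term `W_R = ∫⟪u, φ a⟫` is
   `O((1+E₀)/R)` with `W_R' = ∫⟪∂ₜu, φ a⟫`; since `‖f(t)‖_{L²}` is only INTEGRABLE in `t` (not
   bounded — this is exactly where the printed "bounded `C`" fails), the identity is integrated in
   time instead of being used pointwise: `t ↦ ∂ₐh_f(t, x₀)` is a.e. strongly measurable (limit of
   difference quotients) and integrable on `(0,T)`, `|∫_{t₀}^{t₁} ∂ₐh_f| ≤ M/R → 0`, so every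
   interval integral vanishes and `∂ₐh_f(·, x₀) = 0` a.e. (π-λ over rational intervals). The
   tree's unforced argument (`HarmonicProbe.eq_zero_of_approx_antiderivative`, uniform in `t`) is
   the special case in which every time is good.
4. (`tao2011_forced_pressure_normalisation_ae_holds`) countably many centres (a dense set) and the
   three coordinate directions, continuity of `∇h_f(t, ·)`, `h_f(t, x) = h_f(t, 0) =: C(t)`
   measurable in `t` (clamped parametric integrals), `Q[u(t)] = normalisedPressure (u t)`.

No definitions, no named facts.

## Mathlib / tree search

Everything is assembled from the tree: `laplacian_pressure_eq_of_isClassicalNSSolutionOn`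
(pressure Poisson WITH force, `PressurePoisson`), `laplacian_pressurePotential`,
`contDiff_pressurePotential` (`PressureRepresentation`), `laplacian_forcePotential`,
`contDiff_forcePotential` (`ForcePotentialRepresentation`),
`fderiv_harmonic_eq_integral_probeBump`, `integral_fderiv_mul_comp_sub` (`HarmonicProbe`),
`integral_inner_laplacian_comm`, `integral_inner_convect_add_eq_zero`
(`ClassicalSolutionCalculus`).

## References

* T. Tao, *Localisation and compactness properties of the Navier–Stokes global regularity
  problem*, Anal. PDE 6 (2013) 25–107 = arXiv:1108.1165, §4, proof of Lemma 4.1 (i)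
  (arXiv Lemma 25 (i), pp. 14–15), and (8)–(9) p. 5. [Tao2011]
* D. Gilbarg, N. S. Trudinger, *Elliptic Partial Differential Equations of Second Order*,
  Springer 2001, Thm 2.1, Lemma 4.2. [GilbargTrudinger2001]
-/

noncomputable section

open MeasureTheory Set Filter Metric Topology InnerProductSpace Function
open scoped ENNReal RealInnerProductSpace ContDiff Laplacian

namespace Literature.Analysis.FluidPDE

section ForcedProbe

variable {ν T : ℝ} {f u : ℝ → EuclideanSpace ℝ (Fin 3) → EuclideanSpace ℝ (Fin 3)}
  {p : ℝ → EuclideanSpace ℝ (Fin 3) → ℝ}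

/-- A continuous slice with `∫ |g|² dx` integrable is in `L²` (`MemLp` form). [folklore] -/
private theorem memLp_two_of_integrable_sq {g : EuclideanSpace ℝ (Fin 3) → EuclideanSpace ℝ (Fin 3)}
    (hg : Continuous g) (hL2 : Integrable fun y => ‖g y‖ ^ 2) : MemLp g 2 volume :=
  (memLp_two_iff_integrable_sq_norm hg.aestronglyMeasurable).2 hL2

/-- **The forced harmonic part of the pressure is harmonic** (Tao 2011, §4: "`p = p₀ + h` with
`h` harmonic", `p₀ = -Δ⁻¹∂ᵢ∂ⱼ(uᵢuⱼ) + Δ⁻¹∇·f`, from (8)–(9)): for a classical solution of the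
forced system on `[0, T]` with smooth force, at an interior time with square-integrable slices
`u(t)`, `f(t)`, the function `h_f(t) = p(t) - Q[u(t)] - Φ[f(t)]` is harmonic on `ℝ³`
(`Δp = -div((u·∇)u) + ∇·f`, `ΔQ = -div((u·∇)u)` for `div u = 0`, `ΔΦ[f] = ∇·f`). [cite: Tao2011, §4, proof of Lemma 4.1 (i)] -/
theorem harmonicOnNhd_forcedHarmonicPart
    (h : FluidPDE.IsClassicalNSSolutionOn (Icc 0 T) ν f u p)
    (hf : FluidPDE.IsSmoothSpaceTimeOn (Icc 0 T) f) {t : ℝ} (ht : t ∈ Ioo 0 T)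
    (hL2 : Integrable fun y => ‖u t y‖ ^ 2) (hfL2 : Integrable fun y => ‖f t y‖ ^ 2) :
    HarmonicOnNhd (fun x => p t x - pressurePotential (u t) x - forcePotential (f t) x) univ := by
  have htI : t ∈ Icc 0 T := Ioo_subset_Icc_self ht
  have hu : ContDiff ℝ ∞ (u t) := h.contDiff_velocity htI
  have hp : ContDiff ℝ ∞ (p t) := h.contDiff_pressure htI
  have hft : ContDiff ℝ ∞ (f t) := hf.contDiff_slice htI
  have hu4 : ContDiff ℝ 4 (u t) := contDiff_infty.1 hu 4
  have hp2 : ContDiff ℝ 2 (p t) := contDiff_infty.1 hp 2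
  have hf3 : ContDiff ℝ 3 (f t) := contDiff_infty.1 hft 3
  have hf2 : ContDiff ℝ 2 (f t) := contDiff_infty.1 hft 2
  have hfM : MemLp (f t) 2 volume := memLp_two_of_integrable_sq hft.continuous hfL2
  have hQ2 : ContDiff ℝ 2 (pressurePotential (u t)) := contDiff_pressurePotential hu4 hL2
  have hΦ2 : ContDiff ℝ 2 (forcePotential (f t)) := contDiff_forcePotential hf2 hfM
  have hη2 : ContDiff ℝ 2 fun x => p t x - pressurePotential (u t) x - forcePotential (f t) x :=
    (hp2.sub hQ2).sub hΦ2
  have hti : t ∈ interior (Icc 0 T) := by rwa [interior_Icc]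
  have hΔ : ∀ x, Δ (fun x => p t x - pressurePotential (u t) x - forcePotential (f t) x) x = 0 := by
    intro x
    have e : (fun x => p t x - pressurePotential (u t) x - forcePotential (f t) x) =
        (p t - pressurePotential (u t)) - forcePotential (f t) := rfl
    have hpQ : ContDiff ℝ 2 (p t - pressurePotential (u t)) := hp2.sub hQ2
    rw [e, hpQ.contDiffAt.laplacian_sub hΦ2.contDiffAt,
      hp2.contDiffAt.laplacian_sub hQ2.contDiffAt, laplacian_pressurePotential hu4 hL2 x,
      laplacian_pressure_eq_of_isClassicalNSSolutionOn h hti x,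
      pressureSource_eq_of_isDivFree (h.divFree t htI), laplacian_forcePotential hf3 hfM x]
    ring
  intro x _
  exact ⟨hη2.contDiffAt, Eventually.of_forall hΔ⟩

/-- The momentum equation of the forced system solved for the pressure gradient:
`∇p = νΔu - ∂ₜu - (u·∇)u + f`. [folklore] -/
private theorem gradient_pressure_eq_forced (h : FluidPDE.IsClassicalNSSolutionOn (Icc 0 T) ν f u p)
    {t : ℝ} (ht : t ∈ Icc 0 T) (y : EuclideanSpace ℝ (Fin 3)) :
    gradient (p t) y = ν • (Δ (u t)) y - FluidPDE.timeDerivWithin (Icc 0 T) u t y -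
      FluidPDE.convect (u t) (u t) y + f t y := by
  have hm := h.momentum t ht y
  calc gradient (p t) y = ν • (Δ (u t)) y + f t y -
        (FluidPDE.timeDerivWithin (Icc 0 T) u t y + FluidPDE.convect (u t) (u t) y) := by
          rw [hm]; abel
    _ = _ := by abel

/-- **The forced probe identity** (Tao 2011, §4, proof of Lemma 4.1 (i), the computation of
`∫∫ ∇h χ_R` with the force kept): at an interior time `t` with square-integrable slices
`u(t)`, `f(t)`, for every scale `R > 0`, centre `x₀` and direction `a`, the derivative of the
forced harmonic part `h_f(t) = p(t) - Q[u(t)] - Φ[f(t)]` is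
`∂ₐh_f(t, x₀) = ν ∫⟪u, Δφ a⟫ + ∫⟪u, (u·∇φ) a⟫ - ∫⟪∂ₜu, φ a⟫ + ∫⟪f, φ a⟫`
`  - ∫ ∂ₐχ_R(z) Q[u(t)](x₀ - z) dz - ∫ ∂ₐχ_R(z) Φ[f(t)](x₀ - z) dz`, `φ = χ_R(· - x₀)`
(mean-value formula for the gradient of the harmonic `h_f`, then the momentum equation tested
against `φ a`: viscous term by Green's identity, transport term by the trilinear identity and
`div u = 0`, the force term kept as is). [cite: Tao2011, §4, proof of Lemma 4.1 (i)] -/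
theorem fderiv_forcedHarmonicPart_eq (h : FluidPDE.IsClassicalNSSolutionOn (Icc 0 T) ν f u p)
    (hf : FluidPDE.IsSmoothSpaceTimeOn (Icc 0 T) f) {t : ℝ} (ht : t ∈ Ioo 0 T)
    (hL2 : Integrable fun y => ‖u t y‖ ^ 2) (hfL2 : Integrable fun y => ‖f t y‖ ^ 2)
    {R : ℝ} (hR : 0 < R) (x₀ a : EuclideanSpace ℝ (Fin 3)) :
    fderiv ℝ (fun x => p t x - pressurePotential (u t) x - forcePotential (f t) x) x₀ a =
      ν * (∫ y, ⟪u t y, (Δ (fun y => probeBump R (y - x₀))) y • a⟫)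
      + (∫ y, ⟪u t y, fderiv ℝ (fun y => probeBump R (y - x₀)) y (u t y) • a⟫)
      - (∫ y, ⟪FluidPDE.timeDerivWithin (Icc 0 T) u t y, probeBump R (y - x₀) • a⟫)
      + (∫ y, ⟪f t y, probeBump R (y - x₀) • a⟫)
      - (∫ z, fderiv ℝ (probeBump R) z a * pressurePotential (u t) (x₀ - z))
      - ∫ z, fderiv ℝ (probeBump R) z a * forcePotential (f t) (x₀ - z) := by
  haveI : CompleteSpace (EuclideanSpace ℝ (Fin 3)) := inferInstance
  have hT : 0 < T := ht.1.trans ht.2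
  have hS : UniqueDiffOn ℝ (Icc 0 T) := uniqueDiffOn_Icc hT
  have htI : t ∈ Icc 0 T := Ioo_subset_Icc_self ht
  -- regularity of the slices
  have hu : ContDiff ℝ ∞ (u t) := h.contDiff_velocity htI
  have hp : ContDiff ℝ ∞ (p t) := h.contDiff_pressure htI
  have hft : ContDiff ℝ ∞ (f t) := hf.contDiff_slice htI
  have hu4 : ContDiff ℝ 4 (u t) := contDiff_infty.1 hu 4
  have hu2 : ContDiff ℝ 2 (u t) := contDiff_infty.1 hu 2
  have hu1 : ContDiff ℝ 1 (u t) := contDiff_infty.1 hu 1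
  have hp1 : ContDiff ℝ 1 (p t) := contDiff_infty.1 hp 1
  have hf2 : ContDiff ℝ 2 (f t) := contDiff_infty.1 hft 2
  have huc : Continuous (u t) := hu.continuous
  have hfc : Continuous (f t) := hft.continuous
  have hfM : MemLp (f t) 2 volume := memLp_two_of_integrable_sq hfc hfL2
  set Q := pressurePotential (u t) with hQ_def
  have hQ2 : ContDiff ℝ 2 Q := contDiff_pressurePotential hu4 hL2
  have hQc : Continuous Q := hQ2.continuous
  set Φ := forcePotential (f t) with hΦ_def
  have hΦ2 : ContDiff ℝ 2 Φ := contDiff_forcePotential hf2 hfM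
  have hΦc : Continuous Φ := hΦ2.continuous
  have hη := harmonicOnNhd_forcedHarmonicPart h hf ht hL2 hfL2
  -- the bump, its translate and the vector test field
  set χ : EuclideanSpace ℝ (Fin 3) → ℝ := probeBump R with hχ_def
  have hχs : ContDiff ℝ ∞ χ := contDiff_probeBump R
  have hχ1 : ContDiff ℝ 1 χ := contDiff_infty.1 hχs 1
  have hχc : HasCompactSupport χ := hasCompactSupport_probeBump hR
  set φ : EuclideanSpace ℝ (Fin 3) → ℝ := fun y => χ (y - x₀) with hφ_def
  have hφs : ContDiff ℝ ∞ φ := hχs.comp (contDiff_id.sub contDiff_const)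
  have hφ2 : ContDiff ℝ 2 φ := contDiff_infty.1 hφs 2
  have hφ1 : ContDiff ℝ 1 φ := contDiff_infty.1 hφs 1
  have hφc : HasCompactSupport φ := by
    have e : φ = χ ∘ Homeomorph.addRight (-x₀) := by
      funext y; simp [hφ_def, sub_eq_add_neg]
    rw [e]
    exact hχc.comp_homeomorph _
  have hφχ : ∀ y, χ (x₀ - y) = φ y := fun y => by
    simp only [hφ_def, hχ_def]
    rw [← probeBump_neg R (y - x₀), neg_sub]
  set Ψ : EuclideanSpace ℝ (Fin 3) → EuclideanSpace ℝ (Fin 3) := fun y => φ y • a with hΨ_def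
  have hΨ2 : ContDiff ℝ 2 Ψ := hφ2.smul contDiff_const
  have hΨ1 : ContDiff ℝ 1 Ψ := hφ1.smul contDiff_const
  have hΨc : HasCompactSupport Ψ := hφc.smul_right (f' := fun _ => a)
  have hΨcont : Continuous Ψ := hΨ1.continuous
  -- derivatives of the test field
  have hDΨ : ∀ y w, fderiv ℝ Ψ y w = (fderiv ℝ φ y w) • a := fun y w => by
    simp only [hΨ_def]
    rw [fderiv_smul_const (hφ1.differentiable one_ne_zero y), ContinuousLinearMap.smulRight_apply]
  have hΔΨ : ∀ y, (Δ Ψ) y = (Δ φ) y • a := fun y => by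
    have e : Ψ = (ContinuousLinearMap.toSpanSingleton ℝ a) ∘ φ := by
      funext w; simp [hΨ_def, ContinuousLinearMap.toSpanSingleton_apply]
    rw [e, hφ2.contDiffAt.laplacian_CLM_comp_left]
    simp [ContinuousLinearMap.toSpanSingleton_apply]
  -- continuity of the slices entering the momentum equation
  have hΔuc : Continuous (Δ (u t)) := FluidPDE.continuous_laplacian hu2
  have hdtc : Continuous (FluidPDE.timeDerivWithin (Icc 0 T) u t) :=
    ((h.smooth_velocity.timeDerivWithin hS).contDiff_slice htI).continuous
  have hcvc : Continuous (FluidPDE.convect (u t) (u t)) :=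
    (hu1.continuous_fderiv one_ne_zero).clm_apply huc
  -- Step 1: the mean-value formula for the gradient of the harmonic part
  rw [fderiv_harmonic_eq_integral_probeBump hη hR x₀ a]
  -- Step 2: split into the pressure, the potential and the force-potential parts
  have hDχc : Continuous fun z => fderiv ℝ χ z a :=
    (hχ1.continuous_fderiv one_ne_zero).clm_apply continuous_const
  have hDχs : HasCompactSupport fun z => fderiv ℝ χ z a := hχc.fderiv_apply (𝕜 := ℝ) a
  have iP : Integrable fun z => fderiv ℝ χ z a * p t (x₀ - z) :=
    (hDχc.mul (hp.continuous.comp (continuous_const.sub continuous_id))).integrable_of_hasCompactSupport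
      hDχs.mul_right
  have iQ : Integrable fun z => fderiv ℝ χ z a * Q (x₀ - z) :=
    (hDχc.mul (hQc.comp (continuous_const.sub continuous_id))).integrable_of_hasCompactSupport
      hDχs.mul_right
  have iΦ : Integrable fun z => fderiv ℝ χ z a * Φ (x₀ - z) :=
    (hDχc.mul (hΦc.comp (continuous_const.sub continuous_id))).integrable_of_hasCompactSupport
      hDχs.mul_right
  have e2 : ∫ z, fderiv ℝ χ z a * (p t (x₀ - z) - Q (x₀ - z) - Φ (x₀ - z)) =
      (∫ z, fderiv ℝ χ z a * p t (x₀ - z)) - (∫ z, fderiv ℝ χ z a * Q (x₀ - z))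
        - ∫ z, fderiv ℝ χ z a * Φ (x₀ - z) := by
    have iPQ : Integrable fun z => fderiv ℝ χ z a * p t (x₀ - z) - fderiv ℝ χ z a * Q (x₀ - z) :=
      iP.sub iQ
    rw [← integral_sub iP iQ, ← integral_sub iPQ iΦ]
    refine integral_congr_ae (Eventually.of_forall fun z => ?_)
    simp only [mul_sub]
  rw [e2]
  -- Step 3: the pressure part through the momentum equation
  have iL := FluidPDE.integrable_inner_of_hasCompactSupport_right hΔuc hΨcont hΨc
  have iT := FluidPDE.integrable_inner_of_hasCompactSupport_right hdtc hΨcont hΨc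
  have iC := FluidPDE.integrable_inner_of_hasCompactSupport_right hcvc hΨcont hΨc
  have iF := FluidPDE.integrable_inner_of_hasCompactSupport_right hfc hΨcont hΨc
  have e3 : ∫ z, fderiv ℝ χ z a * p t (x₀ - z) = ∫ y, ⟪gradient (p t) y, Ψ y⟫ := by
    rw [integral_fderiv_mul_comp_sub hχ1 hχc hp1 x₀ a,
      ← integral_sub_left_eq_self (fun z => χ z * fderiv ℝ (p t) (x₀ - z) a) volume x₀]
    have hg : ∀ y, ⟪gradient (p t) y, a⟫ = fderiv ℝ (p t) y a := fun y => by
      rw [← FluidPDE.inner_gradient_eq_fderiv_apply, real_inner_comm]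
    refine integral_congr_ae (Eventually.of_forall fun y => ?_)
    simp only [sub_sub_cancel, hΨ_def, inner_smul_right, hg, hφχ y]
  have e4 : ∫ y, ⟪gradient (p t) y, Ψ y⟫ =
      ν * (∫ y, ⟪(Δ (u t)) y, Ψ y⟫) - (∫ y, ⟪FluidPDE.timeDerivWithin (Icc 0 T) u t y, Ψ y⟫) -
        (∫ y, ⟪FluidPDE.convect (u t) (u t) y, Ψ y⟫) + ∫ y, ⟪f t y, Ψ y⟫ := by
    have key : ∀ y, ⟪gradient (p t) y, Ψ y⟫ = ν * ⟪(Δ (u t)) y, Ψ y⟫ -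
        ⟪FluidPDE.timeDerivWithin (Icc 0 T) u t y, Ψ y⟫ - ⟪FluidPDE.convect (u t) (u t) y, Ψ y⟫
          + ⟪f t y, Ψ y⟫ := by
      intro y
      rw [gradient_pressure_eq_forced h htI y, inner_add_left, inner_sub_left, inner_sub_left,
        inner_smul_left]
      simp
    have i2 : Integrable fun y => ν * ⟪(Δ (u t)) y, Ψ y⟫ := iL.const_mul ν
    have i1 : Integrable fun y => ν * ⟪(Δ (u t)) y, Ψ y⟫ -
        ⟪FluidPDE.timeDerivWithin (Icc 0 T) u t y, Ψ y⟫ := i2.sub iT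
    have i0 : Integrable fun y => ν * ⟪(Δ (u t)) y, Ψ y⟫ -
        ⟪FluidPDE.timeDerivWithin (Icc 0 T) u t y, Ψ y⟫ - ⟪FluidPDE.convect (u t) (u t) y, Ψ y⟫ :=
      i1.sub iC
    rw [integral_congr_ae (Eventually.of_forall key), integral_add i0 iF, integral_sub i1 iC,
      integral_sub i2 iT, integral_const_mul]
  -- Green's identity for the viscous term
  have e5 : ∫ y, ⟪(Δ (u t)) y, Ψ y⟫ = ∫ y, ⟪u t y, (Δ φ) y • a⟫ := by
    rw [FluidPDE.integral_inner_laplacian_comm hu2 hΨ2 hΨc]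
    exact integral_congr_ae (Eventually.of_forall fun y => by
      show ⟪u t y, (Δ Ψ) y⟫ = ⟪u t y, (Δ φ) y • a⟫
      rw [hΔΨ y])
  -- the trilinear identity for the transport term
  have e6 : ∫ y, ⟪FluidPDE.convect (u t) (u t) y, Ψ y⟫ =
      -∫ y, ⟪u t y, fderiv ℝ φ y (u t y) • a⟫ := by
    have h0 := FluidPDE.integral_inner_convect_add_eq_zero hu1 hu1 hΨ1 hΨc
    have hz : ∫ y, VectorCalculus.divergence (u t) y * ⟪u t y, Ψ y⟫ = 0 := by
      simp [h.divFree t htI _]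
    have hc : ∫ y, ⟪u t y, FluidPDE.convect (u t) Ψ y⟫ = ∫ y, ⟪u t y, fderiv ℝ φ y (u t y) • a⟫ :=
      integral_congr_ae (Eventually.of_forall fun y => by simp only [FluidPDE.convect, hDΨ])
    linarith
  -- the force term is kept
  have e7 : ∫ y, ⟪f t y, Ψ y⟫ = ∫ y, ⟪f t y, probeBump R (y - x₀) • a⟫ := rfl
  rw [e3, e4, e5, e6, e7]
  ring

end ForcedProbe

/-! ### Tools for the time integration: the boundary term, measurability in time, `‖f(t)‖_{L²}` -/

section TimeTools

variable {T : ℝ} {u f : ℝ → EuclideanSpace ℝ (Fin 3) → EuclideanSpace ℝ (Fin 3)}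
  {p : ℝ → EuclideanSpace ℝ (Fin 3) → ℝ}

/-- **Differentiating the boundary term in time**: for a velocity field jointly smooth on
`[0, T] × ℝ³` and a smooth compactly supported test field `Ψ`, `t ↦ ∫ ⟪u(t, y), Ψ(y)⟫ dy` has
derivative `∫ ⟪∂ₜu(t, y), Ψ(y)⟫ dy` at every interior time (the unforced
`hasDerivAt_integral_inner_velocity`, which only uses the smoothness of `u`). [folklore] -/
private theorem hasDerivAt_integral_inner_velocity' (hu : FluidPDE.IsSmoothSpaceTimeOn (Icc 0 T) u)
    {Ψ : EuclideanSpace ℝ (Fin 3) → EuclideanSpace ℝ (Fin 3)} (hΨ : ContDiff ℝ ∞ Ψ)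
    (hΨc : HasCompactSupport Ψ) {t : ℝ} (ht : t ∈ Ioo 0 T) :
    HasDerivAt (fun s => ∫ y, ⟪u s y, Ψ y⟫)
      (∫ y, ⟪FluidPDE.timeDerivWithin (Icc 0 T) u t y, Ψ y⟫) t := by
  have hΦ : FluidPDE.IsSmoothSpaceTimeOn (Ioo 0 T) fun s y => ⟪u s y, Ψ y⟫ :=
    (hu.mono Ioo_subset_Icc_self).inner (FluidPDE.isSmoothSpaceTimeOn_const_time hΨ _)
  have hsupp : ∀ s ∈ Ioo 0 T, ∀ y ∉ tsupport Ψ, ⟪u s y, Ψ y⟫ = 0 := fun s _ y hy => by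
    rw [image_eq_zero_of_notMem_tsupport hy, inner_zero_right]
  have hD := FluidPDE.hasDerivAt_integral_of_support_subset (μ := volume) isOpen_Ioo hΦ hΨc hsupp ht
  have heq : ∫ y, deriv (fun s => ⟪u s y, Ψ y⟫) t =
      ∫ y, ⟪FluidPDE.timeDerivWithin (Icc 0 T) u t y, Ψ y⟫ := by
    refine integral_congr_ae (Eventually.of_forall fun y => ?_)
    have hl : HasDerivAt (fun s => u s y) (deriv (fun s => u s y) t) t :=
      hu.mono Ioo_subset_Icc_self |>.hasDerivAt_timeLine isOpen_Ioo ht y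
    have := (hl.inner ℝ (hasDerivAt_const t (Ψ y))).deriv
    simp only [inner_zero_right, zero_add] at this
    show deriv (fun s => ⟪u s y, Ψ y⟫) t = ⟪FluidPDE.timeDerivWithin (Icc 0 T) u t y, Ψ y⟫
    rw [this, FluidPDE.timeDerivWithin_eq_deriv_of_mem_nhds (Icc_mem_nhds ht.1 ht.2) u y]
  rwa [heq] at hD

/-- The time-derivative pairing `t ↦ ∫ ⟪∂ₜu(t, y), Ψ(y)⟫ dy` is continuous on `[0, T]`. [folklore] -/
private theorem continuousOn_integral_inner_timeDerivWithin' (hT : 0 < T)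
    (hu : FluidPDE.IsSmoothSpaceTimeOn (Icc 0 T) u)
    {Ψ : EuclideanSpace ℝ (Fin 3) → EuclideanSpace ℝ (Fin 3)} (hΨ : Continuous Ψ)
    (hΨc : HasCompactSupport Ψ) :
    ContinuousOn (fun t => ∫ y, ⟪FluidPDE.timeDerivWithin (Icc 0 T) u t y, Ψ y⟫) (Icc 0 T) := by
  refine FluidPDE.continuousOn_integral_of_support_subset (μ := volume) (K := tsupport Ψ) hΨc ?_ ?_
  · have h1 := hu.continuousOn_timeDerivWithin (uniqueDiffOn_Icc hT)
    have h2 : ContinuousOn (fun z : ℝ × EuclideanSpace ℝ (Fin 3) => Ψ z.2) (Icc 0 T ×ˢ univ) :=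
      (hΨ.comp continuous_snd).continuousOn
    exact h1.inner h2
  · intro s _ y hy
    change ⟪FluidPDE.timeDerivWithin (Icc 0 T) u s y, Ψ y⟫ = 0
    rw [image_eq_zero_of_notMem_tsupport hy, inner_zero_right]

/-- The velocity pairing `t ↦ ∫ ⟪u(t, y), Ψ(y)⟫ dy` is continuous on `[0, T]`. [folklore] -/
private theorem continuousOn_integral_inner_velocity' (hu : FluidPDE.IsSmoothSpaceTimeOn (Icc 0 T) u)
    {Ψ : EuclideanSpace ℝ (Fin 3) → EuclideanSpace ℝ (Fin 3)} (hΨ : Continuous Ψ)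
    (hΨc : HasCompactSupport Ψ) :
    ContinuousOn (fun t => ∫ y, ⟪u t y, Ψ y⟫) (Icc 0 T) := by
  refine FluidPDE.continuousOn_integral_of_support_subset (μ := volume) (K := tsupport Ψ) hΨc ?_ ?_
  · have h2 : ContinuousOn (fun z : ℝ × EuclideanSpace ℝ (Fin 3) => Ψ z.2) (Icc 0 T ×ˢ univ) :=
      (hΨ.comp continuous_snd).continuousOn
    exact hu.continuousOn.inner h2
  · intro s _ y hy
    change ⟪u s y, Ψ y⟫ = 0
    rw [image_eq_zero_of_notMem_tsupport hy, inner_zero_right]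

/-- **Measurability in time of the pressure potential at a fixed point** (the tree's
`measurable_pressurePotential_clamp`, at an arbitrary point `x` instead of `0`): for a velocity
field jointly smooth on `[0, T] × ℝ³`, `t ↦ Q[u(π t)](x)` is measurable, `π` the clamp onto
`[0, T]`. [folklore] -/
private theorem measurable_pressurePotential_clamp_at (hT : 0 < T)
    (hu : FluidPDE.IsSmoothSpaceTimeOn (Icc 0 T) u) (x : EuclideanSpace ℝ (Fin 3)) :
    Measurable fun t => pressurePotential (u (max 0 (min t T))) x := by
  have hS := uniqueDiffOn_Icc hT
  have hG : Continuous fun q : ℝ × EuclideanSpace ℝ (Fin 3) =>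
      pressureSource (u (max 0 (min q.1 T))) (x - q.2) :=
    continuous_clamp_comp hT.le (F := uncurry fun t y => pressureSource (u t) y)
      (hu.pressureSource hS).continuousOn (continuous_const.sub continuous_id)
  have hU : Continuous fun q : ℝ × EuclideanSpace ℝ (Fin 3) => u (max 0 (min q.1 T)) q.2 :=
    hu.continuousOn.comp_continuous
      ((continuous_clamp T).comp continuous_fst |>.prodMk continuous_snd)
      fun q => mk_mem_prod (clamp_mem hT.le q.1) (mem_univ _)
  have h1 : Measurable fun t => nearPotential 1 2 (u (max 0 (min t T))) x := by
    have hF : Measurable fun q : ℝ × EuclideanSpace ℝ (Fin 3) =>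
        newtonNear 1 2 q.2 * pressureSource (u (max 0 (min q.1 T))) (x - q.2) :=
      ((measurable_newtonNear 1 2).comp measurable_snd).mul hG.measurable
    exact (hF.stronglyMeasurable.integral_prod_right' (ν := volume)).measurable
  have h2 : Measurable fun t => farPotential 1 2 (u (max 0 (min t T))) x := by
    have hK : Continuous fun q : ℝ × EuclideanSpace ℝ (Fin 3) =>
        fderiv ℝ (fderiv ℝ (newtonFar 1 2)) (x - q.2) :=
      (contDiff_fderiv2_newtonFar one_pos one_lt_two).continuous.comp
        (continuous_const.sub continuous_snd)
    have hF : Measurable fun q : ℝ × EuclideanSpace ℝ (Fin 3) =>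
        fderiv ℝ (fderiv ℝ (newtonFar 1 2)) (x - q.2) (u (max 0 (min q.1 T)) q.2)
          (u (max 0 (min q.1 T)) q.2) :=
      ((hK.clm_apply hU).clm_apply hU).measurable
    exact (hF.stronglyMeasurable.integral_prod_right' (ν := volume)).measurable
  exact h1.neg.sub h2

/-- **Measurability in time of the force potential at a fixed point**: for a force jointly smooth
on `[0, T] × ℝ³`, `t ↦ Δ⁻¹∇·f(π t)(x)` is measurable (a parametric integral of the jointly
measurable integrand `∇Γ(x - y)·f(π t, y)`). [folklore] -/
private theorem measurable_forcePotential_clamp_at (hT : 0 < T)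
    (hf : FluidPDE.IsSmoothSpaceTimeOn (Icc 0 T) f) (x : EuclideanSpace ℝ (Fin 3)) :
    Measurable fun t => forcePotential (f (max 0 (min t T))) x := by
  have hF : Continuous fun q : ℝ × EuclideanSpace ℝ (Fin 3) => f (max 0 (min q.1 T)) q.2 :=
    hf.continuousOn.comp_continuous
      ((continuous_clamp T).comp continuous_fst |>.prodMk continuous_snd)
      fun q => mk_mem_prod (clamp_mem hT.le q.1) (mem_univ _)
  have hK : Measurable fun q : ℝ × EuclideanSpace ℝ (Fin 3) =>
      forceKernel (x - q.2) (f (max 0 (min q.1 T)) q.2) := by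
    have e : (fun q : ℝ × EuclideanSpace ℝ (Fin 3) => forceKernel (x - q.2) (f (max 0 (min q.1 T)) q.2)) =
        fun q => ⟪x - q.2, f (max 0 (min q.1 T)) q.2⟫ * (4 * Real.pi * ‖x - q.2‖ ^ 3)⁻¹ := by
      funext q; rw [forceKernel_eq_fin3, div_eq_mul_inv]
    rw [e]
    have h1 : Measurable fun q : ℝ × EuclideanSpace ℝ (Fin 3) => x - q.2 :=
      measurable_const.sub measurable_snd
    exact (h1.inner hF.measurable).mul ((measurable_const.mul (h1.norm.pow_const 3)).inv)
  exact (hK.stronglyMeasurable.integral_prod_right' (ν := volume)).measurable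

/-- The pressure at a fixed point, clamped in time, is continuous. [folklore] -/
private theorem continuous_pressure_clamp_at (hT : 0 ≤ T) (hp : FluidPDE.IsSmoothSpaceTimeOn (Icc 0 T) p)
    (x : EuclideanSpace ℝ (Fin 3)) : Continuous fun t => p (max 0 (min t T)) x :=
  hp.continuousOn.comp_continuous ((continuous_clamp T).prodMk continuous_const)
    fun t => mk_mem_prod (clamp_mem hT t) (mem_univ _)

/-- Measurability in time of `∫ |f(π t)|²` for a jointly smooth force (Tonelli measurability of a
jointly continuous integrand). [folklore] -/
private theorem measurable_lintegral_force_sq_clamp (hT : 0 ≤ T)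
    (hf : FluidPDE.IsSmoothSpaceTimeOn (Icc 0 T) f) :
    Measurable fun t => ∫⁻ y, ‖f (max 0 (min t T)) y‖ₑ ^ 2 := by
  have hF : Continuous fun q : ℝ × EuclideanSpace ℝ (Fin 3) => f (max 0 (min q.1 T)) q.2 :=
    hf.continuousOn.comp_continuous
      ((continuous_clamp T).comp continuous_fst |>.prodMk continuous_snd)
      fun q => mk_mem_prod (clamp_mem hT q.1) (mem_univ _)
  exact (hF.measurable.enorm.pow_const 2).lintegral_prod_right

/-- **Good times**: for a force jointly smooth on `[0, T] × ℝ³` with `∫₀ᵀ ‖f(t)‖_{L²} dt < ∞`,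
`∫ |f(t)|² < ∞` for a.e. `t ∈ (0, T)`. [folklore] -/
private theorem ae_lintegral_force_sq_lt_top (hT : 0 < T)
    (hf : FluidPDE.IsSmoothSpaceTimeOn (Icc 0 T) f)
    (hfE : ∫⁻ t in Icc 0 T, (∫⁻ x, ‖f t x‖ₑ ^ 2) ^ (1 / 2 : ℝ) < ⊤) :
    ∀ᵐ t ∂(volume.restrict (Ioo 0 T)), ∫⁻ y, ‖f t y‖ₑ ^ 2 < ⊤ := by
  have hfE' : ∫⁻ t in Icc 0 T, (∫⁻ y, ‖f (max 0 (min t T)) y‖ₑ ^ 2) ^ (1 / 2 : ℝ) < ⊤ := by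
    refine lt_of_le_of_lt (le_of_eq ?_) hfE
    refine setLIntegral_congr_fun measurableSet_Icc (fun t ht => ?_)
    rw [clamp_eq ht]
  have h1 : ∀ᵐ t ∂(volume.restrict (Icc 0 T)),
      (∫⁻ y, ‖f (max 0 (min t T)) y‖ₑ ^ 2) ^ (1 / 2 : ℝ) < ⊤ :=
    ae_lt_top ((measurable_lintegral_force_sq_clamp hT.le hf).pow_const _) hfE'.ne
  have h2 : ∀ᵐ t ∂(volume.restrict (Icc 0 T)), ∫⁻ y, ‖f t y‖ₑ ^ 2 < ⊤ := by
    filter_upwards [h1, ae_restrict_mem measurableSet_Icc] with t ht htI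
    rw [clamp_eq htI] at ht
    by_contra hcon
    rw [not_lt, top_le_iff] at hcon
    rw [hcon, ENNReal.top_rpow_of_pos (by norm_num)] at ht
    exact lt_irrefl _ ht
  exact ae_restrict_of_ae_restrict_of_subset Ioo_subset_Icc_self h2

/-- `‖g‖_{L²} = (∫⁻ ‖g‖ₑ²)^{1/2}` (unfolding `eLpNorm` at `p = 2`). [folklore] -/
private theorem eLpNorm_two_eq_lintegral' (g : EuclideanSpace ℝ (Fin 3) → EuclideanSpace ℝ (Fin 3)) :
    eLpNorm g 2 volume = (∫⁻ y, ‖g y‖ₑ ^ 2) ^ (1 / 2 : ℝ) := by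
  rw [eLpNorm_eq_lintegral_rpow_enorm_toReal two_ne_zero ENNReal.ofNat_ne_top, ENNReal.toReal_ofNat]
  simp only [ENNReal.rpow_ofNat]

/-- **An integrable real function with zero integral over every rational open interval vanishes
a.e.** (π-λ on `Real.borel_eq_generateFrom_Ioo_rat`, then
`Integrable.ae_eq_zero_of_forall_setIntegral_eq_zero`). [folklore] -/
private theorem ae_eq_zero_of_forall_setIntegral_Ioo_rat {g : ℝ → ℝ} (hg : Integrable g)
    (h : ∀ a b : ℚ, ∫ s in Ioo (a : ℝ) b, g s = 0) : g =ᵐ[volume] 0 := by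
  have hI : ∫ s, g s = 0 := by
    have hmono : Monotone fun k : ℕ => Ioo (-(k : ℝ)) k := fun i j hij =>
      Ioo_subset_Ioo (neg_le_neg (Nat.cast_le.mpr hij)) (Nat.cast_le.mpr hij)
    have hU : (⋃ k : ℕ, Ioo (-(k : ℝ)) k) = univ :=
      eq_univ_of_forall fun x => mem_iUnion.mpr
        (let ⟨k, hk⟩ := exists_nat_gt |x|; ⟨k, abs_lt.mp hk⟩)
    have hlim := tendsto_setIntegral_of_monotone (μ := volume) (f := g)
      (fun _ => measurableSet_Ioo) hmono hg.integrableOn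
    have h0 : (fun k : ℕ => ∫ s in Ioo (-(k : ℝ)) k, g s) = fun _ => 0 := by
      funext k
      simpa using h (-k) k
    rw [h0, hU, Measure.restrict_univ] at hlim
    exact (tendsto_const_nhds_iff.mp hlim).symm
  have hcompl : ∀ t, MeasurableSet t → ∫ s in t, g s = 0 → ∫ s in tᶜ, g s = 0 := by
    intro t ht ht0
    have := integral_add_compl ht hg
    rwa [ht0, hI, zero_add] at this
  suffices H : ∀ t, MeasurableSet t → ∫ s in t, g s = 0 from
    hg.ae_eq_zero_of_forall_setIntegral_eq_zero fun t ht _ => H t ht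
  intro t ht
  induction t, ht using MeasurableSpace.induction_on_inter Real.borel_eq_generateFrom_Ioo_rat
    Real.isPiSystem_Ioo_rat with
  | empty => simp
  | basic t ht =>
    simp only [mem_iUnion, mem_singleton_iff] at ht
    obtain ⟨a, b, -, rfl⟩ := ht
    exact h a b
  | compl t ht iht => exact hcompl t ht iht
  | iUnion g' hdisj hmeas hg' =>
    rw [integral_iUnion hmeas hdisj hg.integrableOn]
    simp [hg']

/-- **A directional derivative of an a.e.-differentiable measurable family is a.e. strongly
measurable in the parameter**: if `t ↦ H(t, x)` is measurable for every `x` (here: agrees on the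
time set `S` with a measurable function) and `H(t, ·)` is differentiable at `x₀` for a.e. `t ∈ S`,
then `t ↦ ∂ₐH(t, ·)(x₀)` is a.e. strongly measurable on `S` (limit of the measurable difference
quotients `n (H(t, x₀ + a/n) - H(t, x₀))`, `HasFDerivAt.lim`). [folklore] -/
private theorem aestronglyMeasurable_fderiv_apply_of_ae {S : Set ℝ} (hS : MeasurableSet S)
    {H Hc : ℝ → EuclideanSpace ℝ (Fin 3) → ℝ} (hHc : ∀ x, Measurable fun t => Hc t x)
    (heq : ∀ t ∈ S, ∀ x, H t x = Hc t x) {x₀ a : EuclideanSpace ℝ (Fin 3)}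
    (hdiff : ∀ᵐ t ∂(volume.restrict S), DifferentiableAt ℝ (H t) x₀) :
    AEStronglyMeasurable (fun t => fderiv ℝ (H t) x₀ a) (volume.restrict S) := by
  set DQ : ℕ → ℝ → ℝ := fun n t =>
    ((n : ℝ) + 1) • (H t (x₀ + (((n : ℝ) + 1)⁻¹) • a) - H t x₀) with hDQ
  have hDQm : ∀ n, AEStronglyMeasurable (DQ n) (volume.restrict S) := by
    intro n
    have h1 : Measurable fun t => Hc t (x₀ + (((n : ℝ) + 1)⁻¹) • a) - Hc t x₀ :=
      (hHc _).sub (hHc _)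
    have hm : Measurable fun t => ((n : ℝ) + 1) • (Hc t (x₀ + (((n : ℝ) + 1)⁻¹) • a) - Hc t x₀) := by
      simp only [smul_eq_mul]
      exact h1.const_mul _
    refine (hm.aestronglyMeasurable.congr ?_)
    filter_upwards [ae_restrict_mem hS] with t ht
    simp only [hDQ, heq t ht]
  refine aestronglyMeasurable_of_tendsto_ae atTop hDQm ?_
  filter_upwards [hdiff] with t ht
  have hc : Tendsto (fun n : ℕ => ‖(n : ℝ) + 1‖) atTop atTop := by
    have : Tendsto (fun n : ℕ => (n : ℝ) + 1) atTop atTop :=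
      tendsto_natCast_atTop_atTop.atTop_add tendsto_const_nhds
    refine this.congr' (Eventually.of_forall fun n => ?_)
    show (n : ℝ) + 1 = ‖(n : ℝ) + 1‖
    rw [Real.norm_of_nonneg (by positivity)]
  simp only [hDQ]
  exact ht.hasFDerivAt.lim a hc

end TimeTools

/-! ### `∇h_f(t) = 0` for a.e. time: the time-integrated probe argument -/

section AEVanishing

variable {ν T : ℝ} {f u : ℝ → EuclideanSpace ℝ (Fin 3) → EuclideanSpace ℝ (Fin 3)}
  {p : ℝ → EuclideanSpace ℝ (Fin 3) → ℝ}

/-- **`∂ₐh_f(t, x₀) = 0` for a.e. interior time** (Tao 2011, §4, proof of Lemma 4.1 (i), forced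
case, conclusion). For a classical solution of the forced system on `[0, T] × ℝ³` with smooth
finite-energy force (`∫₀ᵀ ‖f(t)‖_{L²} dt < ∞`) and `sup_t ∫|u(t)|² ≤ E₀`, and fixed `x₀`, `a`:
for a.e. `t ∈ (0, T)` the forced harmonic part `h_f(t) = p(t) - Q[u(t)] - Φ[f(t)]` has
`∂ₐh_f(t, x₀) = 0`. Proof: at the good times (`‖f(t)‖_{L²} < ∞`, a.e.) the forced probe identity
gives `∂ₐh_f(t, x₀) = -W_R'(t) + e_R(t)` with `W_R(t) = ∫⟪u(t), χ_R(· - x₀) a⟫ = O((1+E₀)/R)`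
uniformly and `|e_R(t)| ≤ (K(1 + E₀) + K'‖f(t)‖_{L²})/R`; `t ↦ ∂ₐh_f(t, x₀)` is a.e. strongly
measurable (limit of difference quotients) and integrable, and integrating over `(t₀, t₁)` gives
`|∫_{t₀}^{t₁} ∂ₐh_f(·, x₀)| ≤ (2K₃(1+E₀) + K(1+E₀)T + K'∫₀ᵀ‖f‖_{L²})/R → 0`, so all interval
integrals vanish and `∂ₐh_f(·, x₀) = 0` a.e. (With `f = 0` every time is good and the tree's
`fderiv_harmonicPart_eq_zero` gives the pointwise statement.) [cite: Tao2011, §4, proof of Lemma 4.1 (i)] -/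
theorem fderiv_forcedHarmonicPart_ae_eq_zero (hν : 0 ≤ ν) (hT : 0 < T)
    (h : FluidPDE.IsClassicalNSSolutionOn (Icc 0 T) ν f u p)
    (hf : FluidPDE.IsSmoothSpaceTimeOn (Icc 0 T) f)
    (hfE : ∫⁻ t in Icc 0 T, (∫⁻ x, ‖f t x‖ₑ ^ 2) ^ (1 / 2 : ℝ) < ⊤)
    {E₀ : ℝ} (hE₀ : 0 ≤ E₀) (hint : ∀ t ∈ Icc 0 T, Integrable fun y => ‖u t y‖ ^ 2)
    (hE : ∀ t ∈ Icc 0 T, ∫ y, ‖u t y‖ ^ 2 ≤ E₀) (x₀ a : EuclideanSpace ℝ (Fin 3)) :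
    ∀ᵐ t ∂(volume.restrict (Ioo 0 T)),
      fderiv ℝ (fun x => p t x - pressurePotential (u t) x - forcePotential (f t) x) x₀ a = 0 := by
  have hS : UniqueDiffOn ℝ (Icc 0 T) := uniqueDiffOn_Icc hT
  -- ### notation: the harmonic part, its clamped twin, the derivative `g`
  set H : ℝ → EuclideanSpace ℝ (Fin 3) → ℝ :=
    fun t x => p t x - pressurePotential (u t) x - forcePotential (f t) x with hH
  set Hc : ℝ → EuclideanSpace ℝ (Fin 3) → ℝ := fun t x => p (max 0 (min t T)) x -
    pressurePotential (u (max 0 (min t T))) x - forcePotential (f (max 0 (min t T))) x with hHc_def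
  have hHc : ∀ x, Measurable fun t => Hc t x := fun x =>
    ((continuous_pressure_clamp_at hT.le h.smooth_pressure x).measurable.sub
      (measurable_pressurePotential_clamp_at hT h.smooth_velocity x)).sub
      (measurable_forcePotential_clamp_at hT hf x)
  have hHeq : ∀ t ∈ Icc 0 T, ∀ x, H t x = Hc t x := fun t ht x => by
    simp only [hH, hHc_def, clamp_eq ht]
  set g : ℝ → ℝ := fun t => fderiv ℝ (H t) x₀ a with hg
  show ∀ᵐ t ∂(volume.restrict (Ioo 0 T)), g t = 0
  -- ### the size of the force: `Fc t = ‖f(π t)‖_{L²}` (real, measurable, integrable on `[0,T]`)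
  set Fc : ℝ → ℝ := fun t => ((∫⁻ y, ‖f (max 0 (min t T)) y‖ₑ ^ 2) ^ (1 / 2 : ℝ)).toReal with hFc
  have hFcm : Measurable Fc :=
    ((measurable_lintegral_force_sq_clamp hT.le hf).pow_const _).ennreal_toReal
  have hFc0 : ∀ t, 0 ≤ Fc t := fun t => ENNReal.toReal_nonneg
  have hfE' : ∫⁻ t in Icc 0 T, (∫⁻ y, ‖f (max 0 (min t T)) y‖ₑ ^ 2) ^ (1 / 2 : ℝ) < ⊤ := by
    refine lt_of_le_of_lt (le_of_eq ?_) hfE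
    refine setLIntegral_congr_fun measurableSet_Icc (fun t ht => ?_)
    rw [clamp_eq ht]
  have hFci : IntegrableOn Fc (Icc 0 T) := by
    refine ⟨hFcm.aestronglyMeasurable, ?_⟩
    refine lt_of_le_of_lt (lintegral_mono fun t => ?_) hfE'
    rw [Real.enorm_eq_ofReal (hFc0 t), hFc]
    exact ENNReal.ofReal_toReal_le
  -- ### good times: `∫ |f(t)|² < ∞` for a.e. `t ∈ (0,T)`
  have hgood : ∀ᵐ t ∂(volume.restrict (Ioo 0 T)), ∫⁻ y, ‖f t y‖ₑ ^ 2 < ⊤ :=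
    ae_lintegral_force_sq_lt_top hT hf hfE
  -- consequences at a good time
  have hfL2 : ∀ t ∈ Icc 0 T, ∫⁻ y, ‖f t y‖ₑ ^ 2 < ⊤ → Integrable fun y => ‖f t y‖ ^ 2 :=
    fun t ht hlt => integrable_sq_of_lintegral_enorm_sq_lt_top (hf.contDiff_slice ht).continuous hlt
  have hfFc : ∀ t ∈ Icc 0 T, ∫⁻ y, ‖f t y‖ₑ ^ 2 < ⊤ →
      eLpNorm (f t) 2 volume ≤ ENNReal.ofReal (Fc t) := by
    intro t ht hlt
    simp only [hFc]
    rw [clamp_eq ht, eLpNorm_two_eq_lintegral' (f t), ENNReal.ofReal_toReal]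
    exact (ENNReal.rpow_lt_top_of_nonneg (by norm_num) hlt.ne).ne
  -- ### the probe constants
  obtain ⟨K₁, hK₁0, hK₁⟩ := exists_bound_probe_laplacian a
  obtain ⟨K₂, hK₂0, hK₂⟩ := exists_bound_probe_transport a
  obtain ⟨K₃, hK₃0, hK₃⟩ := exists_bound_probe_boundary a
  obtain ⟨K₄, hK₄0, hK₄⟩ := exists_bound_probe_potential a
  obtain ⟨K₅, hK₅0, hK₅⟩ := exists_bound_probe_force a
  obtain ⟨K₆, hK₆0, hK₆⟩ := exists_bound_probe_forcePotential a
  -- ### the test fields, the boundary term `W_R` and its derivative `C_R`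
  set Ψf : ℝ → EuclideanSpace ℝ (Fin 3) → EuclideanSpace ℝ (Fin 3) :=
    fun R y => probeBump R (y - x₀) • a with hΨf
  have hΨs : ∀ R, ContDiff ℝ ∞ (Ψf R) := fun R =>
    ((contDiff_probeBump (E := EuclideanSpace ℝ (Fin 3)) R).comp (contDiff_id.sub contDiff_const)).smul
      contDiff_const
  have hΨc : ∀ R, 0 < R → HasCompactSupport (Ψf R) := fun R hR => by
    have h1 : HasCompactSupport fun y : EuclideanSpace ℝ (Fin 3) => probeBump R (y - x₀) := by
      have e : (fun y : EuclideanSpace ℝ (Fin 3) => probeBump R (y - x₀)) =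
          probeBump R ∘ Homeomorph.addRight (-x₀) := by
        funext y; simp [sub_eq_add_neg]
      rw [e]
      exact (hasCompactSupport_probeBump hR).comp_homeomorph _
    exact h1.smul_right (f' := fun _ => a)
  set W : ℝ → ℝ → ℝ := fun R t => ∫ y, ⟪u t y, Ψf R y⟫ with hW
  set C : ℝ → ℝ → ℝ := fun R t => ∫ y, ⟪FluidPDE.timeDerivWithin (Icc 0 T) u t y, Ψf R y⟫ with hC
  have hWcont : ∀ R, 0 < R → ContinuousOn (W R) (Icc 0 T) := fun R hR =>
    continuousOn_integral_inner_velocity' h.smooth_velocity (hΨs R).continuous (hΨc R hR)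
  have hCcont : ∀ R, 0 < R → ContinuousOn (C R) (Icc 0 T) := fun R hR =>
    continuousOn_integral_inner_timeDerivWithin' hT h.smooth_velocity (hΨs R).continuous (hΨc R hR)
  have hWderiv : ∀ R, 0 < R → ∀ t ∈ Ioo 0 T, HasDerivAt (W R) (C R t) t := fun R hR t ht =>
    hasDerivAt_integral_inner_velocity' h.smooth_velocity (hΨs R) (hΨc R hR) ht
  have hWbound : ∀ R, 1 ≤ R → ∀ t ∈ Icc 0 T, |W R t| ≤ K₃ * (1 + E₀) * R⁻¹ := fun R hR t ht =>
    hK₃ (u t) E₀ (h.contDiff_velocity ht).continuous (hint t ht) hE₀ (hE t ht) R hR x₀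
  have hCint : ∀ R, 0 < R → IntegrableOn (C R) (Icc 0 T) := fun R hR =>
    (hCcont R hR).integrableOn_compact isCompact_Icc
  -- ### the pointwise identity and the error bound at good times
  set M₁ : ℝ := (ν * K₁ + K₂ + K₄) * (1 + E₀) with hM₁
  set M₂ : ℝ := K₅ + K₆ with hM₂
  have hM₁0 : 0 ≤ M₁ := by positivity
  have hM₂0 : 0 ≤ M₂ := by positivity
  have herr : ∀ R, 1 ≤ R → ∀ᵐ t ∂(volume.restrict (Ioo 0 T)),
      |g t + C R t| ≤ (M₁ + M₂ * Fc t) * R⁻¹ := by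
    intro R hR1
    have hR : 0 < R := one_pos.trans_le hR1
    filter_upwards [hgood, ae_restrict_mem measurableSet_Ioo] with t hgt ht
    have htI : t ∈ Icc 0 T := Ioo_subset_Icc_self ht
    have huc : Continuous (u t) := (h.contDiff_velocity htI).continuous
    have hu2 : ContDiff ℝ 2 (u t) := contDiff_infty.1 (h.contDiff_velocity htI) 2
    have hfc : Continuous (f t) := (hf.contDiff_slice htI).continuous
    have key := fderiv_forcedHarmonicPart_eq h hf ht (hint t htI) (hfL2 t htI hgt) hR x₀ a
    have b1 := hK₁ (u t) E₀ huc (hint t htI) hE₀ (hE t htI) R hR1 x₀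
    have b2 := hK₂ (u t) E₀ huc (hint t htI) hE₀ (hE t htI) R hR1 x₀
    have b4 := hK₄ (u t) E₀ hu2 (hint t htI) hE₀ (hE t htI) R hR1 x₀
    have b5 := hK₅ (f t) (Fc t) hfc (hFc0 t) (hfFc t htI hgt) R hR1 x₀
    have b6 := hK₆ (f t) (Fc t) hfc (hFc0 t) (hfFc t htI hgt) R hR1 x₀
    have eg : g t = fderiv ℝ (H t) x₀ a := rfl
    have eC : C R t = ∫ y, ⟪FluidPDE.timeDerivWithin (Icc 0 T) u t y, probeBump R (y - x₀) • a⟫ := rfl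
    rw [eg, eC, show H t = fun x => p t x - pressurePotential (u t) x - forcePotential (f t) x from rfl,
      key]
    generalize (∫ y, ⟪u t y, (Δ (fun y => probeBump R (y - x₀))) y • a⟫) = A at b1 ⊢
    generalize (∫ y, ⟪u t y, fderiv ℝ (fun y => probeBump R (y - x₀)) y (u t y) • a⟫) = B at b2 ⊢
    generalize (∫ z, fderiv ℝ (probeBump R) z a * pressurePotential (u t) (x₀ - z)) = D at b4 ⊢
    generalize (∫ y, ⟪f t y, probeBump R (y - x₀) • a⟫) = F₀ at b5 ⊢
    generalize (∫ z, fderiv ℝ (probeBump R) z a * forcePotential (f t) (x₀ - z)) = G at b6 ⊢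
    generalize (∫ y, ⟪FluidPDE.timeDerivWithin (Icc 0 T) u t y, probeBump R (y - x₀) • a⟫) = C₀
    have e : ν * A + B - C₀ + F₀ - D - G + C₀ = ν * A + B + F₀ - D - G := by ring
    rw [e]
    calc |ν * A + B + F₀ - D - G| ≤ ν * |A| + |B| + |F₀| + |D| + |G| := by
          calc |ν * A + B + F₀ - D - G| ≤ |ν * A + B + F₀ - D| + |G| := abs_sub _ _
            _ ≤ |ν * A + B + F₀| + |D| + |G| := by gcongr; exact abs_sub _ _
            _ ≤ |ν * A + B| + |F₀| + |D| + |G| := by gcongr; exact abs_add_le _ _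
            _ ≤ |ν * A| + |B| + |F₀| + |D| + |G| := by gcongr; exact abs_add_le _ _
            _ = ν * |A| + |B| + |F₀| + |D| + |G| := by rw [abs_mul, abs_of_nonneg hν]
      _ ≤ ν * (K₁ * (1 + E₀) * R⁻¹) + K₂ * (1 + E₀) * R⁻¹ + K₅ * Fc t * R⁻¹ +
            K₄ * (1 + E₀) * R⁻¹ + K₆ * Fc t * R⁻¹ := by gcongr
      _ = (M₁ + M₂ * Fc t) * R⁻¹ := by rw [hM₁, hM₂]; ring
  -- ### measurability and integrability of `g` on `(0, T)`
  have hgm : AEStronglyMeasurable g (volume.restrict (Ioo 0 T)) := by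
    refine aestronglyMeasurable_fderiv_apply_of_ae measurableSet_Ioo hHc
      (fun t ht x => hHeq t (Ioo_subset_Icc_self ht) x) ?_
    filter_upwards [hgood, ae_restrict_mem measurableSet_Ioo] with t hgt ht
    have htI : t ∈ Icc 0 T := Ioo_subset_Icc_self ht
    have hη := harmonicOnNhd_forcedHarmonicPart h hf ht (hint t htI) (hfL2 t htI hgt)
    exact (hη x₀ (mem_univ _)).1.differentiableAt (by simp)
  obtain ⟨B₁, hB₁⟩ := isCompact_Icc.exists_bound_of_continuousOn (hCcont 1 one_pos)
  have hgi : IntegrableOn g (Ioo 0 T) := by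
    have hdom : IntegrableOn (fun t => B₁ + (M₁ + M₂ * Fc t)) (Ioo 0 T) :=
      (integrableOn_const (measure_Ioo_lt_top.ne)).add
        ((integrableOn_const (measure_Ioo_lt_top.ne)).add
          ((hFci.mono_set Ioo_subset_Icc_self).const_mul M₂))
    refine Integrable.mono' hdom hgm ?_
    filter_upwards [herr 1 le_rfl, ae_restrict_mem measurableSet_Ioo] with t ht htI
    rw [inv_one, mul_one] at ht
    have hC1 : |C 1 t| ≤ B₁ := by
      rw [← Real.norm_eq_abs]; exact hB₁ t (Ioo_subset_Icc_self htI)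
    rw [Real.norm_eq_abs]
    calc |g t| = |(g t + C 1 t) - C 1 t| := by ring_nf
      _ ≤ |g t + C 1 t| + |C 1 t| := abs_sub _ _
      _ ≤ (M₁ + M₂ * Fc t) + B₁ := add_le_add ht hC1
      _ = B₁ + (M₁ + M₂ * Fc t) := add_comm _ _
  -- ### every interval integral of `g` vanishes
  set M : ℝ := (∫ t in Ioo 0 T, (M₁ + M₂ * Fc t)) + 2 * (K₃ * (1 + E₀)) with hMdef
  have hεi : IntegrableOn (fun t => M₁ + M₂ * Fc t) (Ioo 0 T) :=
    (integrableOn_const (measure_Ioo_lt_top.ne)).add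
      ((hFci.mono_set Ioo_subset_Icc_self).const_mul M₂)
  have hinterval : ∀ t₀ t₁ : ℝ, 0 ≤ t₀ → t₀ ≤ t₁ → t₁ ≤ T → ∫ s in Ioo t₀ t₁, g s = 0 := by
    intro t₀ t₁ ht₀ h01 ht₁
    have hsub : Ioo t₀ t₁ ⊆ Ioo 0 T := Ioo_subset_Ioo ht₀ ht₁
    have hsubI : Icc t₀ t₁ ⊆ Icc 0 T := Icc_subset_Icc ht₀ ht₁
    have hbound : ∀ R : ℝ, 1 ≤ R → |∫ s in Ioo t₀ t₁, g s| ≤ M * R⁻¹ := by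
      intro R hR1
      have hR : 0 < R := one_pos.trans_le hR1
      -- the boundary term by the fundamental theorem of calculus
      have hFTC : ∫ s in Ioo t₀ t₁, C R s = W R t₁ - W R t₀ := by
        rw [← integral_Ioc_eq_integral_Ioo, ← intervalIntegral.integral_of_le h01]
        refine intervalIntegral.integral_eq_sub_of_hasDerivAt_of_le h01 ((hWcont R hR).mono hsubI)
          (fun s hs => hWderiv R hR s (hsub hs)) ?_
        exact ((hCcont R hR).mono (by rwa [uIcc_of_le h01])).intervalIntegrable
      have hCi : IntegrableOn (C R) (Ioo t₀ t₁) :=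
        ((hCint R hR).mono_set hsubI).mono_set Ioo_subset_Icc_self
      have hgi' : IntegrableOn g (Ioo t₀ t₁) := hgi.mono_set hsub
      -- split `g = (g + C_R) - C_R`
      have hsplit : ∫ s in Ioo t₀ t₁, g s =
          (∫ s in Ioo t₀ t₁, (g s + C R s)) - ∫ s in Ioo t₀ t₁, C R s := by
        rw [integral_add hgi' hCi]; ring
      -- the error integral
      have herrI : |∫ s in Ioo t₀ t₁, (g s + C R s)| ≤ (∫ t in Ioo 0 T, (M₁ + M₂ * Fc t)) * R⁻¹ := by
        have h1 : |∫ s in Ioo t₀ t₁, (g s + C R s)| ≤ ∫ s in Ioo t₀ t₁, (M₁ + M₂ * Fc s) * R⁻¹ := by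
          rw [← Real.norm_eq_abs]
          refine norm_integral_le_of_norm_le ((hεi.mono_set hsub).mul_const _) ?_
          refine ae_restrict_of_ae_restrict_of_subset hsub ?_
          filter_upwards [herr R hR1] with s hs
          rw [Real.norm_eq_abs]; exact hs
        have h2 : ∫ s in Ioo t₀ t₁, (M₁ + M₂ * Fc s) * R⁻¹ ≤ ∫ s in Ioo 0 T, (M₁ + M₂ * Fc s) * R⁻¹ := by
          refine setIntegral_mono_set (hεi.mul_const _) ?_ hsub.eventuallyLE
          filter_upwards with s
          exact mul_nonneg (by positivity) (inv_nonneg.2 hR.le)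
        refine h1.trans (h2.trans (le_of_eq ?_))
        rw [integral_mul_const]
      -- assemble
      rw [hsplit, hFTC]
      calc |(∫ s in Ioo t₀ t₁, (g s + C R s)) - (W R t₁ - W R t₀)|
          ≤ |∫ s in Ioo t₀ t₁, (g s + C R s)| + |W R t₁ - W R t₀| := abs_sub _ _
        _ ≤ |∫ s in Ioo t₀ t₁, (g s + C R s)| + (|W R t₁| + |W R t₀|) := by
            gcongr; exact abs_sub _ _
        _ ≤ (∫ t in Ioo 0 T, (M₁ + M₂ * Fc t)) * R⁻¹ +
              (K₃ * (1 + E₀) * R⁻¹ + K₃ * (1 + E₀) * R⁻¹) :=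
            add_le_add herrI (add_le_add (hWbound R hR1 t₁ ⟨ht₀.trans h01, ht₁⟩)
              (hWbound R hR1 t₀ ⟨ht₀, h01.trans ht₁⟩))
        _ = M * R⁻¹ := by rw [hMdef]; ring
    -- let `R → ∞`
    have hlim : Tendsto (fun R : ℝ => M * R⁻¹) atTop (𝓝 0) := by
      simpa using tendsto_inv_atTop_zero.const_mul M
    have hle : |∫ s in Ioo t₀ t₁, g s| ≤ 0 :=
      ge_of_tendsto hlim (Filter.eventually_atTop.2 ⟨1, fun R hR => hbound R hR⟩)
    exact abs_nonpos_iff.1 hle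
  -- ### conclusion: `g = 0` a.e. on `(0, T)`
  have hind : (Ioo 0 T).indicator g =ᵐ[volume] 0 := by
    refine ae_eq_zero_of_forall_setIntegral_Ioo_rat ((integrable_indicator_iff measurableSet_Ioo).2 hgi)
      (fun qa qb => ?_)
    rw [setIntegral_indicator measurableSet_Ioo, Ioo_inter_Ioo]
    by_cases hlt : max (qa : ℝ) 0 < min (qb : ℝ) T
    · exact hinterval _ _ (le_max_right _ _) hlt.le (min_le_right _ _)
    · rw [Ioo_eq_empty hlt, Measure.restrict_empty, integral_zero_measure]
  have h2 : ∀ᵐ t ∂(volume : Measure ℝ), (Ioo 0 T).indicator g t = 0 := hind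
  filter_upwards [ae_restrict_of_ae h2, ae_restrict_mem measurableSet_Ioo] with t ht htI
  rwa [indicator_of_mem htI] at ht

end AEVanishing

/-! ### The discharge of `tao2011_forced_pressure_normalisation_ae` -/

section Discharge

/-- A continuous linear functional on `ℝ³` vanishing on the standard basis vanishes. [folklore] -/
private theorem clm_eq_zero_of_apply_single {L : EuclideanSpace ℝ (Fin 3) →L[ℝ] ℝ}
    (h : ∀ i, L (EuclideanSpace.single i (1 : ℝ)) = 0) : L = 0 := by
  ext v
  have hv : v = ∑ i, v i • EuclideanSpace.single i (1 : ℝ) := by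
    conv_lhs => rw [← (EuclideanSpace.basisFun (Fin 3) ℝ).sum_repr v]
    simp [EuclideanSpace.basisFun_apply]
  rw [hv, map_sum]
  simp [h]

/-- **Tao 2011, Lemma 4.1 (i) WITH a force — the corrected (a.e.) form, discharged.** For a
classical finite-energy solution of the forced Navier–Stokes system on `[0, T] × ℝ³` with smooth
finite-energy force (`∫₀ᵀ ‖f(t)‖_{L²} dt < ∞`, `sup_t ∫|u(t)|² < ∞`), there is a measurable
`C : ℝ → ℝ` with `p(t, x) = -Δ⁻¹∂ᵢ∂ⱼ(uᵢuⱼ)(t, x) + Δ⁻¹∇·f(t, x) + C(t)` for a.e. `t ∈ [0, T]` and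
every `x`. Proof = Tao's (arXiv pp. 14–15), slice-wise at the good times `‖f(t)‖_{L²} < ∞`:
`p = Q[u] + Φ[f] + h_f` with `h_f(t)` harmonic (`harmonicOnNhd_forcedHarmonicPart`); the
time-integrated probe argument gives `∂ₐh_f(t, x₀) = 0` for a.e. `t`, for each `x₀` of a countable
dense set and each coordinate direction (`fderiv_forcedHarmonicPart_ae_eq_zero`), hence
`∇h_f(t) = 0` by continuity of `∇h_f(t, ·)` and `h_f(t, x) = h_f(t, 0) =: C(t)`;
`Q[u(t)] = normalisedPressure (u t)` by the principal-value representation; `C` (clamped in `t`)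
is measurable. `C` need NOT be bounded (`TaoForcedPressureNormalisationCounterexample`). [cite: Tao2011, Lemma 4.1 (i)] -/
theorem tao2011_forced_pressure_normalisation_ae_holds : tao2011_forced_pressure_normalisation_ae := by
  intro ν T hν hT f u p hsol hf hfE hEn
  obtain ⟨C₀, hC₀⟩ := hEn
  -- the energy in real form
  have hint : ∀ t ∈ Icc 0 T, Integrable fun y => ‖u t y‖ ^ 2 := fun t ht =>
    integrable_sq_of_lintegral_enorm_sq_lt_top (hsol.contDiff_velocity ht).continuous
      ((hC₀ t ht).trans_lt ENNReal.coe_lt_top)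
  have hE : ∀ t ∈ Icc 0 T, ∫ y, ‖u t y‖ ^ 2 ≤ (C₀ : ℝ) := fun t ht => by
    have h1 := hC₀ t ht
    rw [← ofReal_integral_norm_sq_eq_lintegral (hint t ht)] at h1
    have h2 := (ENNReal.ofReal_le_iff_le_toReal ENNReal.coe_ne_top).1 h1
    rwa [ENNReal.coe_toReal] at h2
  have hE0 : 0 ≤ (C₀ : ℝ) := C₀.coe_nonneg
  -- the normalising constant, clamped in time
  refine ⟨fun t => p (max 0 (min t T)) 0 - pressurePotential (u (max 0 (min t T))) 0 -
    forcePotential (f (max 0 (min t T))) 0, ?_, ?_⟩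
  · exact ((continuous_pressure_clamp_at hT.le hsol.smooth_pressure 0).measurable.sub
      (measurable_pressurePotential_clamp_at hT hsol.smooth_velocity 0)).sub
      (measurable_forcePotential_clamp_at hT hf 0)
  -- a countable dense set of centres and the coordinate directions
  obtain ⟨S, hSc, hSd⟩ := TopologicalSpace.exists_countable_dense (EuclideanSpace ℝ (Fin 3))
  haveI : Countable S := hSc.to_subtype
  have hall : ∀ᵐ t ∂(volume.restrict (Ioo 0 T)), ∀ x₀ : S, ∀ i : Fin 3,
      fderiv ℝ (fun x => p t x - pressurePotential (u t) x - forcePotential (f t) x) x₀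
        (EuclideanSpace.single i (1 : ℝ)) = 0 :=
    ae_all_iff.2 fun x₀ => ae_all_iff.2 fun i =>
      fderiv_forcedHarmonicPart_ae_eq_zero hν.le hT hsol hf hfE hE0 hint hE (x₀ : EuclideanSpace ℝ (Fin 3))
        (EuclideanSpace.single i (1 : ℝ))
  have hgood := ae_lintegral_force_sq_lt_top hT hf hfE
  -- at a.e. interior time the harmonic part is constant in space
  have hIoo : ∀ᵐ t ∂(volume.restrict (Ioo 0 T)), ∀ x,
      p t x - pressurePotential (u t) x - forcePotential (f t) x =
        p t 0 - pressurePotential (u t) 0 - forcePotential (f t) 0 := by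
    filter_upwards [hall, hgood, ae_restrict_mem measurableSet_Ioo] with t hall hgt ht
    have htI : t ∈ Icc 0 T := Ioo_subset_Icc_self ht
    have hfL2 : Integrable fun y => ‖f t y‖ ^ 2 :=
      integrable_sq_of_lintegral_enorm_sq_lt_top (hf.contDiff_slice htI).continuous hgt
    have hη := harmonicOnNhd_forcedHarmonicPart hsol hf ht (hint t htI) hfL2
    set η : EuclideanSpace ℝ (Fin 3) → ℝ :=
      fun x => p t x - pressurePotential (u t) x - forcePotential (f t) x with hη_def
    have hC2 : ContDiff ℝ 2 η := contDiff_two_of_harmonicOnNhd_univ hη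
    have hzeroS : ∀ x₀ ∈ S, fderiv ℝ η x₀ = 0 := fun x₀ hx₀ =>
      clm_eq_zero_of_apply_single fun i => hall ⟨x₀, hx₀⟩ i
    have hcont : Continuous (fderiv ℝ η) := hC2.continuous_fderiv (by simp)
    have hzero : fderiv ℝ η = fun _ => 0 :=
      Continuous.ext_on hSd hcont continuous_const fun x hx => hzeroS x hx
    intro x
    exact is_const_of_fderiv_eq_zero (hC2.differentiable (by simp)) (fun y => congrFun hzero y) x 0
  -- from `(0, T)` to `[0, T]` (the endpoints are null) and the final rewriting
  have h1 : ∀ᵐ t ∂((volume : Measure ℝ).restrict (Icc 0 T)), t ∈ Icc 0 T :=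
    ae_restrict_mem measurableSet_Icc
  have h2 : ∀ᵐ t ∂(volume : Measure ℝ), t ∉ ({0} : Set ℝ) ∧ t ∉ ({T} : Set ℝ) :=
    (measure_eq_zero_iff_ae_notMem.1 (measure_singleton 0)).and
      (measure_eq_zero_iff_ae_notMem.1 (measure_singleton T))
  have h3 : ∀ᵐ t ∂(volume : Measure ℝ), t ∈ Ioo 0 T → ∀ x,
      p t x - pressurePotential (u t) x - forcePotential (f t) x =
        p t 0 - pressurePotential (u t) 0 - forcePotential (f t) 0 :=
    (ae_restrict_iff' measurableSet_Ioo).1 hIoo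
  filter_upwards [h1, ae_restrict_of_ae h2, ae_restrict_of_ae h3] with t ht hne hP
  have htIoo : t ∈ Ioo 0 T := by
    simp only [mem_singleton_iff] at hne
    exact ⟨lt_of_le_of_ne ht.1 (Ne.symm hne.1), lt_of_le_of_ne ht.2 hne.2⟩
  intro x
  have hu2 : ContDiff ℝ 2 (u t) := contDiff_infty.1 (hsol.contDiff_velocity ht) 2
  rw [clamp_eq ht, normalisedPressure_eq_pressurePotential hu2 (hint t ht) x]
  have := hP htIoo x
  linarith

end Discharge

end Literature.Analysis.FluidPDE

end
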